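import Mathlib
import HarnessLib
import Summits.NavierStokesRegularity.NavierStokesRegularity.Theorems.PoloidalWindowDoorPoloidalWindowRigidityZShockRiccatiTwoSided
import Summits.NavierStokesRegularity.NavierStokesRegularity.Theorems.PoloidalWindowDoorPoloidalWindowRigidityZShockCharacteristicRiccati
import Summits.NavierStokesRegularity.NavierStokesRegularity.Theorems.PoloidalWindowDoorPoloidalWindowRigidityZShockGlobalCharacteristics

/-!
# Crux K2 `PoloidalWindowRigidity` (stmt-NavierStokesRegularity-19708), line `z_shock` — RUNG R2: the TWO-SIDED LIOUVILLE THEOREM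
# for the autonomous genuinely nonlinear p-system (Lax 1964 / John 1974 read two-sidedly)

`--supports stmt-NavierStokesRegularity-19708 --as helper` (leafhand-ns-poloidalwindowdoor-1 g0, 2026-08-30).  Class-free,
Mathlib only.  **No stub and no summit is closed by this file; Navier–Stokes regularity is NOT proved here.**

Rung R2 of `Cruxes/PoloidalWindowRigidity/Lines/z_shock.md` — the 1-D shadow of the deciding stub `stub_zShockThickAut`
(«THICK = genuine nonlinearity + two-sided eternal boundedness ⇒ gradient catastrophe unless constant»): the height-evolution
`∂_z φ = G(w)`, `∂_z w = −Δₕφ` in ONE horizontal variable `x` is, with `p := φ_x` and `κ := (−G')^{1/2} > 0`, the p-system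
`p_z = −κ(w)² w_x`, `w_z = −p_x`.  THEOREM (`pSystem_const`): if `w, p ∈ C²(ℝ × ℝ)` solve it on the WHOLE plane (two-sided in the
height `z` = first coordinate), with `w_x` bounded, `0 < κ_lo ≤ κ ≤ κ_hi`, `|κ'| ≤ k₁` and GENUINE NONLINEARITY `κ' ≥ k₀ > 0`
(`G'' ≠ 0`, one sign), then `w` and `p` are constant.  Proof (all steps kernel-checked here or in the three imported tree files):
Riemann invariants `r, s = p ± K(w)` (`K' = κ`) satisfy `r_z + κ(w) r_x = 0`, `s_z − κ(w) s_x = 0`; through every point pass GLOBAL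
`±κ(w)`-characteristics (`…ZShockGlobalCharacteristics.exists_global_solution`: the speed is bounded and uniformly Lipschitz); along
them `α = r_x` (resp. `β = s_x`) obeys `α' = −(κ(w))_x α = −(κ'/2κ)α² + (κ'/2κ)s_x α` (`transversal_deriv_along_of_speed`, Lax's
(2.6) with a space–time speed), and John's weight `h = ½ log κ(w)` has `h' = −(κ'/2κ) s_x` along the curve (`(d/dz) w = −s_x`
there), so the damped two-sided Riccati lemma (`…ZShockRiccatiTwoSided.dampedRiccati_twoSided_eq_zero`, `a = κ'/2κ ≥ k₀/2κ_hi`)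
gives `r_x ≡ 0`, symmetrically `s_x ≡ 0`, whence `p_x = w_x = w_z = p_z = 0`.

This is exactly the card's R2 («paper-complete WITH autonomy, Lean-L»); autonomy is load-bearing (the card's bent-front example
shows R2 is FALSE for `z`-dependent `κ`).  Hypotheses are stated with global bounds on `κ, κ'` over `ℝ` (modify `κ` off the range of
`w` to apply it to a bounded solution). [folklore]
-/

noncomputable section

namespace Summit.NavierStokesRegularity.NavierStokesRegularity.Theorems.PoloidalWindowDoorPoloidalWindowRigidityZShockPSystemLiouville

-- the problem directory repeats the summit name (`NavierStokesRegularity/NavierStokesRegularity`)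
set_option linter.dupNamespace false

open Set Filter Topology Function Metric
open scoped NNReal
open Summit.NavierStokesRegularity.NavierStokesRegularity.Theorems.PoloidalWindowDoorPoloidalWindowRigidityZShockRiccatiTwoSided
open Summit.NavierStokesRegularity.NavierStokesRegularity.Theorems.PoloidalWindowDoorPoloidalWindowRigidityZShockCharacteristicRiccati
open Summit.NavierStokesRegularity.NavierStokesRegularity.Theorems.PoloidalWindowDoorPoloidalWindowRigidityZShockGlobalCharacteristics

/-! ## Lax's identity with a space–time speed, and the family lemma -/

/-- **Lax's identity, space–time speed.**  If `r ∈ C²(ℝ × ℝ)`, `c` is differentiable, `∂_z r + c·∂_x r = 0` everywhere and `X` is a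
`c`-characteristic (`X' = c(z, X z)`), then `α(z) := ∂_x r (z, X z)` satisfies `α' = −(∂_x c)·α` along the curve. [folklore] -/
theorem transversal_deriv_along_of_speed {r c : ℝ × ℝ → ℝ} (hr : ContDiff ℝ 2 r) (hc : Differentiable ℝ c)
    (hPDE : ∀ q, fderiv ℝ r q (1, 0) + c q * fderiv ℝ r q (0, 1) = 0)
    {X : ℝ → ℝ} (hX : ∀ z, HasDerivAt X (c (z, X z)) z) (z : ℝ) :
    HasDerivAt (fun t => fderiv ℝ r (t, X t) (0, 1))
      (-(fderiv ℝ c (z, X z) (0, 1) * fderiv ℝ r (z, X z) (0, 1))) z := by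
  have hD2c : ContDiff ℝ 1 (fderiv ℝ r) := hr.fderiv_right (by norm_num)
  have hD2 : Differentiable ℝ (fderiv ℝ r) := hD2c.differentiable (by simp)
  have hdir : ∀ (v : ℝ × ℝ) (q : ℝ × ℝ),
      HasFDerivAt (fun q' => fderiv ℝ r q' v) ((ContinuousLinearMap.apply ℝ ℝ v).comp (fderiv ℝ (fderiv ℝ r) q)) q :=
    fun v q => (ContinuousLinearMap.apply ℝ ℝ v).hasFDerivAt.comp q (hD2 q).hasFDerivAt
  have hsymm : fderiv ℝ (fderiv ℝ r) (z, X z) (0, 1) (1, 0) = fderiv ℝ (fderiv ℝ r) (z, X z) (1, 0) (0, 1) :=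
    (hr.contDiffAt.isSymmSndFDerivAt (by simp)) (0, 1) (1, 0)
  have hg : DifferentiableAt ℝ (fun q => fderiv ℝ r q (0, 1)) (z, X z) := (hdir (0, 1) (z, X z)).differentiableAt
  have hα := hasDerivAt_along (F := fun q => fderiv ℝ r q (0, 1)) hg (hX z)
  have hg1 : fderiv ℝ (fun q => fderiv ℝ r q (0, 1)) (z, X z) (1, 0) =
      fderiv ℝ (fderiv ℝ r) (z, X z) (1, 0) (0, 1) := by
    rw [(hdir (0, 1) (z, X z)).fderiv]; simp
  have hg2 : fderiv ℝ (fun q => fderiv ℝ r q (0, 1)) (z, X z) (0, 1) =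
      fderiv ℝ (fderiv ℝ r) (z, X z) (0, 1) (0, 1) := by
    rw [(hdir (0, 1) (z, X z)).fderiv]; simp
  have hΦ : HasFDerivAt (fun q => fderiv ℝ r q (1, 0) + c q * fderiv ℝ r q (0, 1))
      ((ContinuousLinearMap.apply ℝ ℝ (1, 0)).comp (fderiv ℝ (fderiv ℝ r) (z, X z)) +
        (c (z, X z) • (ContinuousLinearMap.apply ℝ ℝ (0, 1)).comp (fderiv ℝ (fderiv ℝ r) (z, X z)) +
          fderiv ℝ r (z, X z) (0, 1) • fderiv ℝ c (z, X z))) (z, X z) :=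
    (hdir (1, 0) (z, X z)).add ((hc (z, X z)).hasFDerivAt.mul (hdir (0, 1) (z, X z)))
  have hΦ0 : fderiv ℝ (fun q => fderiv ℝ r q (1, 0) + c q * fderiv ℝ r q (0, 1)) (z, X z) = 0 := by
    rw [show (fun q => fderiv ℝ r q (1, 0) + c q * fderiv ℝ r q (0, 1)) = fun _ => (0 : ℝ) from funext hPDE]
    exact fderiv_const_apply 0
  have hkey : fderiv ℝ (fderiv ℝ r) (z, X z) (0, 1) (1, 0) +
      (c (z, X z) * fderiv ℝ (fderiv ℝ r) (z, X z) (0, 1) (0, 1) +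
        fderiv ℝ r (z, X z) (0, 1) * fderiv ℝ c (z, X z) (0, 1)) = 0 := by
    have h := congrArg (fun L : ℝ × ℝ →L[ℝ] ℝ => L (0, 1)) hΦ.fderiv
    rw [hΦ0] at h
    simpa [ContinuousLinearMap.comp_apply, ContinuousLinearMap.apply_apply] using h.symm
  refine hα.congr_deriv ?_
  rw [hg1, hg2, ← hsymm]
  linear_combination hkey

/-- **The family lemma (Lax identity + John weight + two-sided damped Riccati).**  Let `r ∈ C²`, `c` differentiable with
`∂_z r + c·∂_x r = 0`, `X` a GLOBAL `c`-characteristic, and suppose that along the curve the coefficient splits as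
`(∂_x c)·(∂_x r) = a·(∂_x r)² + h'·(∂_x r)` with `a ≥ a₀ > 0` and `h` bounded (`|h| ≤ H`, `h' =` its derivative).  Then
`∂_x r ≡ 0` along the curve. [folklore] -/
theorem transversal_eq_zero_of_split {r c : ℝ × ℝ → ℝ} (hr : ContDiff ℝ 2 r) (hc : Differentiable ℝ c)
    (hPDE : ∀ q, fderiv ℝ r q (1, 0) + c q * fderiv ℝ r q (0, 1) = 0)
    {X : ℝ → ℝ} (hX : ∀ z, HasDerivAt X (c (z, X z)) z)
    {a h h' : ℝ → ℝ} {a₀ H : ℝ} (ha₀ : 0 < a₀) (ha : ∀ z, a₀ ≤ a z) (hH : ∀ z, |h z| ≤ H)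
    (hh : ∀ z, HasDerivAt h (h' z) z)
    (hsplit : ∀ z, fderiv ℝ c (z, X z) (0, 1) * fderiv ℝ r (z, X z) (0, 1) =
      a z * fderiv ℝ r (z, X z) (0, 1) ^ 2 + h' z * fderiv ℝ r (z, X z) (0, 1)) :
    ∀ z, fderiv ℝ r (z, X z) (0, 1) = 0 := by
  refine dampedRiccati_twoSided_eq_zero (α := fun t => fderiv ℝ r (t, X t) (0, 1)) ha₀ ha hH hh fun z => ?_
  have hL := transversal_deriv_along_of_speed hr hc hPDE hX z
  refine hL.congr_deriv ?_
  rw [hsplit z]; ring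

/-! ## The p-system -/

/-- **Two-sided Liouville for the autonomous genuinely nonlinear p-system** (`p_z = −κ(w)² w_x`, `w_z = −p_x` on all of
`ℝ × ℝ`): under the hypotheses of the module docstring, `∂_x w ≡ 0`, `∂_x p ≡ 0`, `∂_z w ≡ 0`, `∂_z p ≡ 0`. [folklore] -/
theorem pSystem_derivs_eq_zero {w p : ℝ × ℝ → ℝ} {κ κ' K : ℝ → ℝ} (hw : ContDiff ℝ 2 w) (hp : ContDiff ℝ 2 p)
    (hK2 : ContDiff ℝ 2 K) (hKd : ∀ v, HasDerivAt K (κ v) v) (hκd : ∀ v, HasDerivAt κ (κ' v) v)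
    (hsys1 : ∀ q, fderiv ℝ p q (1, 0) = -(κ (w q) ^ 2 * fderiv ℝ w q (0, 1)))
    (hsys2 : ∀ q, fderiv ℝ w q (1, 0) = -fderiv ℝ p q (0, 1))
    {κlo κhi k₀ k₁ W₁ : ℝ} (hκlo0 : 0 < κlo) (hκlo : ∀ v, κlo ≤ κ v) (hκhi : ∀ v, κ v ≤ κhi)
    (hk₀ : 0 < k₀) (hgnl : ∀ v, k₀ ≤ κ' v) (hk₁ : ∀ v, |κ' v| ≤ k₁) (hW₁ : ∀ q, |fderiv ℝ w q (0, 1)| ≤ W₁) :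
    ∀ q : ℝ × ℝ, fderiv ℝ w q (0, 1) = 0 ∧ fderiv ℝ p q (0, 1) = 0 ∧
      fderiv ℝ w q (1, 0) = 0 ∧ fderiv ℝ p q (1, 0) = 0 := by
  have hw1 : Differentiable ℝ w := hw.differentiable (by simp)
  have hp1 : Differentiable ℝ p := hp.differentiable (by simp)
  have hκ1 : Differentiable ℝ κ := fun v => (hκd v).differentiableAt
  have hκpos : ∀ v, 0 < κ v := fun v => hκlo0.trans_le (hκlo v)
  have hκhi0 : 0 < κhi := hκlo0.trans_le ((hκlo 0).trans (hκhi 0))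
  -- Riemann invariants
  set r : ℝ × ℝ → ℝ := fun q => p q + K (w q) with hrdef
  set s : ℝ × ℝ → ℝ := fun q => p q - K (w q) with hsdef
  have hr2 : ContDiff ℝ 2 r := hp.add (hK2.comp hw)
  have hs2 : ContDiff ℝ 2 s := hp.sub (hK2.comp hw)
  have hKw : ∀ q, HasFDerivAt (fun q' => K (w q')) (κ (w q) • fderiv ℝ w q) q :=
    fun q => (hKd (w q)).comp_hasFDerivAt q (hw1 q).hasFDerivAt
  have hrF : ∀ q, HasFDerivAt r (fderiv ℝ p q + κ (w q) • fderiv ℝ w q) q :=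
    fun q => (hp1 q).hasFDerivAt.add (hKw q)
  have hsF : ∀ q, HasFDerivAt s (fderiv ℝ p q - κ (w q) • fderiv ℝ w q) q :=
    fun q => (hp1 q).hasFDerivAt.sub (hKw q)
  have hrD : ∀ q v, fderiv ℝ r q v = fderiv ℝ p q v + κ (w q) * fderiv ℝ w q v := by
    intro q v
    rw [(hrF q).fderiv]
    simp [smul_eq_mul]
  have hsD : ∀ q v, fderiv ℝ s q v = fderiv ℝ p q v - κ (w q) * fderiv ℝ w q v := by
    intro q v
    rw [(hsF q).fderiv]
    simp [smul_eq_mul]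
  -- the two speeds and the diagonal equations
  set c₁ : ℝ × ℝ → ℝ := fun q => κ (w q) with hc₁
  set c₂ : ℝ × ℝ → ℝ := fun q => -κ (w q) with hc₂
  have hκw : ∀ q, HasFDerivAt (fun q' => κ (w q')) (κ' (w q) • fderiv ℝ w q) q :=
    fun q => (hκd (w q)).comp_hasFDerivAt q (hw1 q).hasFDerivAt
  have hc₁d : Differentiable ℝ c₁ := fun q => (hκw q).differentiableAt
  have hc₂d : Differentiable ℝ c₂ := fun q => (hκw q).neg.differentiableAt
  have hc₁x : ∀ q, fderiv ℝ c₁ q (0, 1) = κ' (w q) * fderiv ℝ w q (0, 1) := by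
    intro q; rw [hc₁, (hκw q).fderiv]; simp [smul_eq_mul]
  have hc₂F : ∀ q, HasFDerivAt c₂ (-(κ' (w q) • fderiv ℝ w q)) q := fun q => (hκw q).neg
  have hc₂x : ∀ q, fderiv ℝ c₂ q (0, 1) = -(κ' (w q) * fderiv ℝ w q (0, 1)) := by
    intro q; rw [(hc₂F q).fderiv]; simp [smul_eq_mul]
  have hPDE1 : ∀ q, fderiv ℝ r q (1, 0) + c₁ q * fderiv ℝ r q (0, 1) = 0 := by
    intro q; rw [hrD, hrD, hc₁, hsys1, hsys2]; ring
  have hPDE2 : ∀ q, fderiv ℝ s q (1, 0) + c₂ q * fderiv ℝ s q (0, 1) = 0 := by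
    intro q; rw [hsD, hsD, hc₂, hsys1, hsys2]; ring
  -- global characteristics for both speeds
  have hW₁0 : 0 ≤ W₁ := (abs_nonneg _).trans (hW₁ 0)
  have hk₁0 : 0 ≤ k₁ := (abs_nonneg _).trans (hk₁ 0)
  have hchar : ∀ σ : ℝ, (σ = 1 ∨ σ = -1) → ∀ z₀ x₀ : ℝ, ∃ X : ℝ → ℝ, X z₀ = x₀ ∧
      ∀ z, HasDerivAt X (σ * κ (w (z, X z))) z := by
    intro σ hσ z₀ x₀
    have hσ1 : |σ| = 1 := by rcases hσ with h | h <;> simp [h]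
    have hsl : ∀ z x, HasDerivAt (fun x' => σ * κ (w (z, x'))) (σ * (κ' (w (z, x)) * fderiv ℝ w (z, x) (0, 1))) x := by
      intro z x
      have hγ : HasDerivAt (fun x' : ℝ => ((z, x') : ℝ × ℝ)) ((0 : ℝ), (1 : ℝ)) x :=
        (hasDerivAt_const x z).prodMk (hasDerivAt_id x)
      have h1 : HasDerivAt (fun x' => κ (w (z, x'))) ((κ' (w (z, x)) • fderiv ℝ w (z, x)) ((0 : ℝ), (1 : ℝ))) x :=
        (hκw (z, x)).comp_hasDerivAt x hγ
      have h2 := h1.const_mul σ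
      simpa [smul_eq_mul] using h2
    refine exists_global_solution (F := fun z x => σ * κ (w (z, x))) (K := Real.toNNReal (k₁ * W₁))
      (B := Real.toNNReal κhi) (fun z => ?_) (fun x => ?_) (fun z x => ?_) z₀ x₀
    · refine lipschitzWith_of_nnnorm_deriv_le (fun x => (hsl z x).differentiableAt) fun x => ?_
      rw [(hsl z x).deriv, ← NNReal.coe_le_coe, coe_nnnorm, Real.coe_toNNReal _ (mul_nonneg hk₁0 hW₁0),
        Real.norm_eq_abs, abs_mul, hσ1, one_mul, abs_mul]
      exact mul_le_mul (hk₁ _) (hW₁ _) (abs_nonneg _) hk₁0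
    · exact continuous_const.mul (hκ1.continuous.comp (hw1.continuous.comp (continuous_id.prodMk continuous_const)))
    · rw [Real.norm_eq_abs, abs_mul, hσ1, one_mul, abs_of_pos (hκpos _), Real.coe_toNNReal _ hκhi0.le]
      exact hκhi _
  -- John's weight `h = ½ log κ(w)` along a curve, and the bounds
  set H : ℝ := (|Real.log κlo| + |Real.log κhi|) / 2 with hHdef
  have hlogbd : ∀ v, |Real.log (κ v) / 2| ≤ H := by
    intro v
    have h1 : Real.log κlo ≤ Real.log (κ v) := Real.log_le_log hκlo0 (hκlo v)
    have h2 : Real.log (κ v) ≤ Real.log κhi := Real.log_le_log (hκpos v) (hκhi v)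
    rw [abs_div, abs_two, hHdef]
    have : |Real.log (κ v)| ≤ |Real.log κlo| + |Real.log κhi| := by
      rcases le_total 0 (Real.log (κ v)) with h0 | h0
      · rw [abs_of_nonneg h0]; linarith [le_abs_self (Real.log κhi), abs_nonneg (Real.log κlo)]
      · rw [abs_of_nonpos h0]; linarith [neg_abs_le (Real.log κlo), abs_nonneg (Real.log κhi)]
    linarith
  set a₀ : ℝ := k₀ / (2 * κhi) with ha₀def
  have ha₀ : 0 < a₀ := by positivity
  have habd : ∀ v, a₀ ≤ κ' v / (2 * κ v) := by
    intro v
    rw [ha₀def, div_le_div_iff₀ (by positivity) (by linarith [hκpos v])]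
    have := hgnl v; have := hκhi v; have := hκpos v
    nlinarith
  -- derivative of `w` along a `σκ`-characteristic, and the John weight
  have halong : ∀ (σ : ℝ) (X : ℝ → ℝ), (∀ z, HasDerivAt X (σ * κ (w (z, X z))) z) → ∀ z,
      HasDerivAt (fun t => Real.log (κ (w (t, X t))) / 2)
        (κ' (w (z, X z)) * (fderiv ℝ w (z, X z) (1, 0) + σ * κ (w (z, X z)) * fderiv ℝ w (z, X z) (0, 1)) /
          (2 * κ (w (z, X z)))) z := by
    intro σ X hX z
    have hwz := hasDerivAt_along (F := w) (hw1 (z, X z)) (hX z)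
    have hκz := (hκd (w (z, X z))).comp z hwz
    have hκne : κ (w (z, X z)) ≠ 0 := (hκpos _).ne'
    have hlog := (hκz.log hκne).div_const 2
    refine hlog.congr_deriv ?_
    simp only [Function.comp_apply]
    field_simp
  intro q
  obtain ⟨z₀, x₀⟩ := q
  -- r-family: speed `κ(w)`
  obtain ⟨X₁, hX₁0, hX₁⟩ := hchar 1 (Or.inl rfl) z₀ x₀
  have hX₁' : ∀ z, HasDerivAt X₁ (c₁ (z, X₁ z)) z := fun z => by simpa [hc₁] using hX₁ z
  have hr0 : ∀ z, fderiv ℝ r (z, X₁ z) (0, 1) = 0 := by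
    refine transversal_eq_zero_of_split hr2 hc₁d hPDE1 hX₁' ha₀
      (a := fun z => κ' (w (z, X₁ z)) / (2 * κ (w (z, X₁ z)))) (fun z => habd _)
      (h := fun t => Real.log (κ (w (t, X₁ t))) / 2) (fun z => hlogbd _) (halong 1 X₁ hX₁) fun z => ?_
    rw [hc₁x, hrD, hsys2]
    have hκne : κ (w (z, X₁ z)) ≠ 0 := (hκpos _).ne'
    field_simp
    ring
  -- s-family: speed `-κ(w)`
  obtain ⟨X₂, hX₂0, hX₂⟩ := hchar (-1) (Or.inr rfl) z₀ x₀
  have hX₂' : ∀ z, HasDerivAt X₂ (c₂ (z, X₂ z)) z := fun z => by simpa [hc₂] using hX₂ z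
  have hs0 : ∀ z, fderiv ℝ s (z, X₂ z) (0, 1) = 0 := by
    refine transversal_eq_zero_of_split hs2 hc₂d hPDE2 hX₂' ha₀
      (a := fun z => κ' (w (z, X₂ z)) / (2 * κ (w (z, X₂ z)))) (fun z => habd _)
      (h := fun t => Real.log (κ (w (t, X₂ t))) / 2) (fun z => hlogbd _) (halong (-1) X₂ hX₂) fun z => ?_
    rw [hc₂x, hsD, hsys2]
    have hκne : κ (w (z, X₂ z)) ≠ 0 := (hκpos _).ne'
    field_simp
    ring
  -- at the base point
  have h1 := hr0 z₀
  have h2 := hs0 z₀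
  rw [hX₁0] at h1
  rw [hX₂0] at h2
  rw [hrD] at h1
  rw [hsD] at h2
  have hκne : κ (w (z₀, x₀)) ≠ 0 := (hκpos _).ne'
  have hwx : fderiv ℝ w (z₀, x₀) (0, 1) = 0 := by
    have : 2 * κ (w (z₀, x₀)) * fderiv ℝ w (z₀, x₀) (0, 1) = 0 := by linear_combination h1 - h2
    rcases mul_eq_zero.1 this with h | h
    · exact absurd h (mul_ne_zero two_ne_zero hκne)
    · exact h
  have hpx : fderiv ℝ p (z₀, x₀) (0, 1) = 0 := by
    have : 2 * fderiv ℝ p (z₀, x₀) (0, 1) = 0 := by linear_combination h1 + h2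
    linarith
  refine ⟨hwx, hpx, ?_, ?_⟩
  · rw [hsys2, hpx, neg_zero]
  · rw [hsys1, hwx, mul_zero, neg_zero]

/-- **R2 (constancy).**  Under the hypotheses of `pSystem_derivs_eq_zero`, the two-sided eternal solution `(w, p)` of the autonomous
genuinely nonlinear p-system is a CONSTANT STATE. [folklore] -/
theorem pSystem_const {w p : ℝ × ℝ → ℝ} {κ κ' K : ℝ → ℝ} (hw : ContDiff ℝ 2 w) (hp : ContDiff ℝ 2 p)
    (hK2 : ContDiff ℝ 2 K) (hKd : ∀ v, HasDerivAt K (κ v) v) (hκd : ∀ v, HasDerivAt κ (κ' v) v)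
    (hsys1 : ∀ q, fderiv ℝ p q (1, 0) = -(κ (w q) ^ 2 * fderiv ℝ w q (0, 1)))
    (hsys2 : ∀ q, fderiv ℝ w q (1, 0) = -fderiv ℝ p q (0, 1))
    {κlo κhi k₀ k₁ W₁ : ℝ} (hκlo0 : 0 < κlo) (hκlo : ∀ v, κlo ≤ κ v) (hκhi : ∀ v, κ v ≤ κhi)
    (hk₀ : 0 < k₀) (hgnl : ∀ v, k₀ ≤ κ' v) (hk₁ : ∀ v, |κ' v| ≤ k₁) (hW₁ : ∀ q, |fderiv ℝ w q (0, 1)| ≤ W₁) :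
    ∀ q q' : ℝ × ℝ, w q = w q' ∧ p q = p q' := by
  have hall := pSystem_derivs_eq_zero hw hp hK2 hKd hκd hsys1 hsys2 hκlo0 hκlo hκhi hk₀ hgnl hk₁ hW₁
  have hw1 : Differentiable ℝ w := hw.differentiable (by simp)
  have hp1 : Differentiable ℝ p := hp.differentiable (by simp)
  have hDw : ∀ q, fderiv ℝ w q = 0 := fun q => by
    refine ContinuousLinearMap.ext fun v => ?_
    obtain ⟨a, b⟩ := v
    rw [Literature.Geometry.Riemannian.clm_prod_apply_eq, (hall q).1, (hall q).2.2.1]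
    simp
  have hDp : ∀ q, fderiv ℝ p q = 0 := fun q => by
    refine ContinuousLinearMap.ext fun v => ?_
    obtain ⟨a, b⟩ := v
    rw [Literature.Geometry.Riemannian.clm_prod_apply_eq, (hall q).2.1, (hall q).2.2.2]
    simp
  intro q q'
  exact ⟨is_const_of_fderiv_eq_zero hw1 hDw q q', is_const_of_fderiv_eq_zero hp1 hDp q q'⟩

end Summit.NavierStokesRegularity.NavierStokesRegularity.Theorems.PoloidalWindowDoorPoloidalWindowRigidityZShockPSystemLiouville

end
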